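import Literature.Geometry.Lorentzian.FlatParallelFrame
import Mathlib.Analysis.ODE.ExistUnique
import HarnessLib

/-!
# Uniqueness for first-order linear covariant equations along a curve

Family `gr` / differential geometry; namespace `Literature.Geometry.Lorentzian`.

Let `∇` be a covariant derivative on the tangent bundle of a manifold `M` modelled on `𝓘(ℝ, E)`,
locally `C^∞` (`CovariantDerivative.IsLocallyContMDiff ∞`), let `A` be a continuous field of
endomorphisms of `TM` (a continuous section of the bundle `Hom(TM, TM)`), `γ : ℝ → M` a `C¹` curve and
`W` a vector field along `γ` with differentiable lift solving the first-order linear equation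

  `DW/dt = A_{γ t} (W t)`   for all `t`

(`covariantDerivAlong` of `Geodesic.lean`). **If `W` vanishes at one parameter it vanishes
identically** (`eq_zero_of_covariantDerivAlong_eq_apply`). This is the uniqueness half of the
standard existence-and-uniqueness theorem for linear ODEs along curves (O'Neill 1983, Ch. 3,
Prop. 3.19 treats the case `A = 0`, parallel transport; Lee, *Riemannian Manifolds*, Thm. 4.31); it
is used with `A = ∇Y` for a vector field `Y` (the field `E(s) = dψ_s(T) − T ∘ ψ_s` measuring the
failure of a flow to preserve a commuting vector field solves `D_s E = ∇_E Y`).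

Proof: in the chart at `γ s₁` the coefficient vector `w(t) = e(W t)` solves the linear system
`w' = (Â(t) − Γ(γ t, γ̇ t)) w` (`continuousLinearMapAt_covariantDerivAlong_symmL_Γmat`, the chart
formula for `D/dt`, and the hom-bundle trivialisation `Â` of `A`), whose coefficient is continuous,
hence bounded near `s₁`; Grönwall / Picard–Lindelöf uniqueness (Mathlib's
`ODE_solution_unique_of_mem_Ioo`) gives `w = 0` near any zero, and a connectedness argument on `ℝ`
concludes.

* `hasDerivAt_trivializationAt_of_covariantDerivAlong_eq` — the coefficient equation;
* `exists_nhds_eq_zero_of_covariantDerivAlong_eq` — local propagation of zeros (with a locally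
  uniform parameter window);
* `eq_zero_of_covariantDerivAlong_eq_apply` — the global statement on `ℝ`.

## References

* B. O'Neill, *Semi-Riemannian geometry*, Academic Press 1983, Ch. 3, Prop. 3.18 (the induced
  covariant derivative in coordinates) and Prop. 3.19 (parallel transport: existence and uniqueness
  for the linear system) (key `ONeill1983`).
* J. M. Lee, *Introduction to Riemannian Manifolds*, 2nd ed., Springer 2018, Thm. 4.31 (existence
  and uniqueness for linear ODEs along curves) (key `Lee2018`).
-/

noncomputable section

open Bundle Set Filter Function Metric
open scoped Manifold ContDiff Topology NNReal

namespace Literature.Geometry.Lorentzian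

universe u

variable {E : Type u} [NormedAddCommGroup E] [NormedSpace ℝ E] [FiniteDimensional ℝ E]
  {M : Type*} [TopologicalSpace M] [ChartedSpace E M] [IsManifold 𝓘(ℝ, E) ∞ M]

/-- **The coefficient equation.** Along a curve `γ` differentiable at `t` with `γ t` in the chart
domain of `x₁`, a field `W` with differentiable lift solving `DW/dt (t) = A_{γ t}(W t)` has
coefficient vector `w = e₁(W ·)` (trivialisation at `x₁`) with
`w'(t) = Â(t) w(t) − Γ(γ t, U t) w(t)`, where `Â(t)` is `A_{γ t}` read in the trivialisation
(`ContinuousLinearMap.inCoordinates`) and `U t` the coordinate velocity (the chart formula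
`continuousLinearMapAt_covariantDerivAlong_symmL_Γmat`). O'Neill 1983, Ch. 3, Prop. 3.18.
[cite: ONeill1983, Ch. 3, Prop. 3.18] -/
theorem hasDerivAt_trivializationAt_of_covariantDerivAlong_eq
    (cov : CovariantDerivative 𝓘(ℝ, E) E (TangentSpace 𝓘(ℝ, E) : M → Type _))
    (hcov : cov.IsLocallyContMDiff ∞) (x₁ : M)
    (A : Π x : M, TangentSpace 𝓘(ℝ, E) x →L[ℝ] TangentSpace 𝓘(ℝ, E) x)
    {γ : ℝ → M} {W : Π t : ℝ, TangentSpace 𝓘(ℝ, E) (γ t)} {t : ℝ}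
    (ht : γ t ∈ (chartAt E x₁).source) (hγ : MDifferentiableAt 𝓘(ℝ, ℝ) 𝓘(ℝ, E) γ t)
    (hW : MDifferentiableAt 𝓘(ℝ, ℝ) (𝓘(ℝ, E).tangent)
      (fun t' ↦ (TotalSpace.mk' E (γ t') (W t') : TangentBundle 𝓘(ℝ, E) M)) t)
    (hODE : covariantDerivAlong cov γ W t = A (γ t) (W t)) :
    HasDerivAt (fun t' ↦ (trivializationAt E (TangentSpace 𝓘(ℝ, E) : M → Type _) x₁
        ⟨γ t', W t'⟩).2)
      (ContinuousLinearMap.inCoordinates E (TangentSpace 𝓘(ℝ, E) : M → Type _) E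
          (TangentSpace 𝓘(ℝ, E) : M → Type _) x₁ (γ t) x₁ (γ t) (A (γ t))
          ((trivializationAt E (TangentSpace 𝓘(ℝ, E) : M → Type _) x₁ ⟨γ t, W t⟩).2) -
        Γmat cov hcov x₁ (γ t)
          ((trivializationAt E (TangentSpace 𝓘(ℝ, E) : M → Type _) x₁ ⟨γ t, velocity 𝓘(ℝ, E) γ t⟩).2)
          ((trivializationAt E (TangentSpace 𝓘(ℝ, E) : M → Type _) x₁ ⟨γ t, W t⟩).2)) t := by
  set e := trivializationAt E (TangentSpace 𝓘(ℝ, E) : M → Type _) x₁ with he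
  have hbase : γ t ∈ e.baseSet := by simpa [he] using ht
  set w : ℝ → E := fun t' ↦ (e ⟨γ t', W t'⟩).2 with hw
  -- `w` is differentiable at `t`
  have hwd : DifferentiableAt ℝ w t := differentiableAt_trivialization_lift e hW hbase
  -- `W` agrees near `t` with the frame combination `e.symmL (γ ·) (w ·)`
  have hev : ∀ᶠ t' in 𝓝 t, γ t' ∈ e.baseSet :=
    hγ.continuousAt.preimage_mem_nhds (e.open_baseSet.mem_nhds hbase)
  have heqW : ∀ᶠ t' in 𝓝 t, W t' = e.symmL ℝ (γ t') (w t') := by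
    filter_upwards [hev] with t' ht'
    simp only [hw]
    rw [← Trivialization.continuousLinearMapAt_apply_of_mem ℝ e ht',
      Trivialization.symmL_continuousLinearMapAt _ ht']
  -- the chart formula for the frame combination
  have hchart := continuousLinearMapAt_covariantDerivAlong_symmL_Γmat cov hcov x₁ ht hγ hwd
  rw [← covariantDerivAlong_congr_field cov heqW, hODE] at hchart
  -- the left-hand side is `Â(t) (w t)`
  have hlhs : e.continuousLinearMapAt ℝ (γ t) (A (γ t) (W t)) =
      ContinuousLinearMap.inCoordinates E (TangentSpace 𝓘(ℝ, E) : M → Type _) E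
        (TangentSpace 𝓘(ℝ, E) : M → Type _) x₁ (γ t) x₁ (γ t) (A (γ t)) (w t) := by
    simp only [ContinuousLinearMap.inCoordinates, ContinuousLinearMap.comp_apply]
    congr 2
    simp only [hw]
    rw [← Trivialization.continuousLinearMapAt_apply_of_mem ℝ e hbase,
      Trivialization.symmL_continuousLinearMapAt _ hbase]
  rw [hlhs] at hchart
  -- conclude
  have hderiv : deriv w t = ContinuousLinearMap.inCoordinates E (TangentSpace 𝓘(ℝ, E) : M → Type _) E
        (TangentSpace 𝓘(ℝ, E) : M → Type _) x₁ (γ t) x₁ (γ t) (A (γ t)) (w t) -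
      Γmat cov hcov x₁ (γ t) ((e ⟨γ t, velocity 𝓘(ℝ, E) γ t⟩).2) (w t) :=
    eq_sub_of_add_eq hchart.symm
  rw [← hderiv]
  exact hwd.hasDerivAt

section Local

/-- **Local propagation of zeros, with a locally uniform window.** Under the hypotheses of the file
(locally `C^∞` connection, continuous endomorphism field `A`, `C¹` curve, differentiable lift,
`DW/dt = A(W)` everywhere), every parameter `s₁` has a window `(s₁ − ε, s₁ + ε)` such that if `W`
vanishes somewhere in the window it vanishes on the whole window: in the chart at `γ s₁` the
coefficient vector solves a linear system with continuous, hence bounded, coefficient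
(`hasDerivAt_trivializationAt_of_covariantDerivAlong_eq`), and Picard–Lindelöf uniqueness
(Mathlib's `ODE_solution_unique_of_mem_Ioo`) compares it with the zero solution. O'Neill 1983,
Ch. 3, Prop. 3.19 (uniqueness for the linear system); Lee 2018, Thm. 4.31.
[cite: ONeill1983, Ch. 3, Prop. 3.19] -/
theorem exists_window_eq_zero_of_covariantDerivAlong_eq
    (cov : CovariantDerivative 𝓘(ℝ, E) E (TangentSpace 𝓘(ℝ, E) : M → Type _))
    (hcov : cov.IsLocallyContMDiff ∞)
    (A : Π x : M, TangentSpace 𝓘(ℝ, E) x →L[ℝ] TangentSpace 𝓘(ℝ, E) x)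
    (hA : Continuous fun x ↦ (⟨x, A x⟩ : TotalSpace (E →L[ℝ] E)
      fun x : M ↦ TangentSpace 𝓘(ℝ, E) x →L[ℝ] TangentSpace 𝓘(ℝ, E) x))
    {γ : ℝ → M} (hγ : ContMDiff 𝓘(ℝ, ℝ) 𝓘(ℝ, E) 1 γ)
    {W : Π t : ℝ, TangentSpace 𝓘(ℝ, E) (γ t)}
    (hW : ∀ t, MDifferentiableAt 𝓘(ℝ, ℝ) (𝓘(ℝ, E).tangent)
      (fun t' ↦ (TotalSpace.mk' E (γ t') (W t') : TangentBundle 𝓘(ℝ, E) M)) t)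
    (hODE : ∀ t, covariantDerivAlong cov γ W t = A (γ t) (W t)) (s₁ : ℝ) :
    ∃ ε > 0, (∃ s₂ ∈ Ioo (s₁ - ε) (s₁ + ε), W s₂ = 0) → ∀ s ∈ Ioo (s₁ - ε) (s₁ + ε), W s = 0 := by
  set x₁ := γ s₁ with hx₁
  set e := trivializationAt E (TangentSpace 𝓘(ℝ, E) : M → Type _) x₁ with he
  have hmd : ∀ s, MDifferentiableAt 𝓘(ℝ, ℝ) 𝓘(ℝ, E) γ s := fun s ↦
    hγ.contMDiffAt.mdifferentiableAt one_ne_zero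
  -- a closed window inside the chart domain of `x₁`
  obtain ⟨ε, hε, hwin⟩ : ∃ ε > 0, ∀ s ∈ Icc (s₁ - ε) (s₁ + ε), γ s ∈ (chartAt E x₁).source := by
    have h : ∀ᶠ s in 𝓝 s₁, γ s ∈ (chartAt E x₁).source :=
      hγ.continuous.continuousAt.preimage_mem_nhds
        ((chartAt E x₁).open_source.mem_nhds (mem_chart_source E x₁))
    obtain ⟨δ, hδ, hball⟩ := Metric.eventually_nhds_iff.1 h
    refine ⟨δ / 2, by positivity, fun s hs ↦ hball ?_⟩
    rw [Real.dist_eq, abs_lt]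
    constructor <;> linarith [hs.1, hs.2]
  have hbase : ∀ s ∈ Icc (s₁ - ε) (s₁ + ε), γ s ∈ e.baseSet := fun s hs ↦ by
    simpa [he] using hwin s hs
  have hsrc : ∀ s ∈ Icc (s₁ - ε) (s₁ + ε), γ s ∈ (extChartAt 𝓘(ℝ, E) x₁).source := fun s hs ↦ by
    rw [extChartAt_source]; exact hwin s hs
  -- the coefficient vector, the coordinate velocity, the coefficient of the linear system
  set w : ℝ → E := fun s ↦ (e ⟨γ s, W s⟩).2 with hw
  set U : ℝ → E := fun s ↦ (e ⟨γ s, velocity 𝓘(ℝ, E) γ s⟩).2 with hU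
  set Ah : ℝ → E →L[ℝ] E := fun s ↦ ContinuousLinearMap.inCoordinates E
    (TangentSpace 𝓘(ℝ, E) : M → Type _) E (TangentSpace 𝓘(ℝ, E) : M → Type _) x₁ (γ s) x₁ (γ s)
      (A (γ s)) with hAh
  set C : ℝ → E →L[ℝ] E := fun s ↦ Ah s - Γmat cov hcov x₁ (γ s) (U s) with hC
  -- the linear system
  have hwderiv : ∀ s ∈ Icc (s₁ - ε) (s₁ + ε), HasDerivAt w (C s (w s)) s := fun s hs ↦
    hasDerivAt_trivializationAt_of_covariantDerivAlong_eq cov hcov x₁ A (hwin s hs) (hmd s)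
      (hW s) (hODE s)
  -- continuity of the coordinate velocity
  have hO : IsOpen (γ ⁻¹' (chartAt E x₁).source) :=
    (chartAt E x₁).open_source.preimage hγ.continuous
  have hcγ : ContDiffOn ℝ 1 (extChartAt 𝓘(ℝ, E) x₁ ∘ γ) (γ ⁻¹' (chartAt E x₁).source) :=
    contMDiffOn_iff_contDiffOn.1
      ((contMDiffOn_extChartAt (n := 1)).comp hγ.contMDiffOn fun s hs ↦ hs)
  have hUc : ContinuousOn U (Icc (s₁ - ε) (s₁ + ε)) := by
    have h1 : ContinuousOn (deriv (extChartAt 𝓘(ℝ, E) x₁ ∘ γ)) (γ ⁻¹' (chartAt E x₁).source) :=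
      hcγ.continuousOn_deriv_of_isOpen hO le_rfl
    refine (h1.mono fun s hs ↦ hwin s hs).congr fun s hs ↦ ?_
    exact ((hasDerivAt_extChartAt_comp (hmd s) (hwin s hs)).deriv).symm
  -- continuity of the connection matrix along the curve (as in the parallel-transport construction)
  have hΓc : ContinuousOn (fun s ↦ Γmat cov hcov x₁ (γ s) (U s)) (Icc (s₁ - ε) (s₁ + ε)) := by
    have hG := (contDiffOn_Γmat cov hcov x₁).continuousOn
    have hq : ContinuousOn (fun s ↦ ((extChartAt 𝓘(ℝ, E) x₁) (γ s), U s)) (Icc (s₁ - ε) (s₁ + ε)) := by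
      refine ContinuousOn.prodMk (fun s hs ↦ ?_) hUc
      exact ((continuousAt_extChartAt' (hsrc s hs)).comp (hmd s).continuousAt).continuousWithinAt
    have hmaps : MapsTo (fun s ↦ ((extChartAt 𝓘(ℝ, E) x₁) (γ s), U s)) (Icc (s₁ - ε) (s₁ + ε))
        ((extChartAt 𝓘(ℝ, E) x₁).target ×ˢ univ) := fun s hs ↦
      ⟨(extChartAt 𝓘(ℝ, E) x₁).map_source (hsrc s hs), mem_univ _⟩
    refine (hG.comp hq hmaps).congr fun s hs ↦ ?_
    simp only [Function.comp_apply]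
    rw [(extChartAt 𝓘(ℝ, E) x₁).left_inv (hsrc s hs)]
  -- continuity of the trivialised endomorphism field along the curve
  have hAhc : ContinuousOn Ah (Icc (s₁ - ε) (s₁ + ε)) := by
    set eH := trivializationAt (E →L[ℝ] E)
      (fun x : M ↦ TangentSpace 𝓘(ℝ, E) x →L[ℝ] TangentSpace 𝓘(ℝ, E) x) x₁ with heH
    have hsec : Continuous fun s ↦ (⟨γ s, A (γ s)⟩ : TotalSpace (E →L[ℝ] E)
        fun x : M ↦ TangentSpace 𝓘(ℝ, E) x →L[ℝ] TangentSpace 𝓘(ℝ, E) x) :=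
      hA.comp hγ.continuous
    have hmaps : MapsTo (fun s ↦ (⟨γ s, A (γ s)⟩ : TotalSpace (E →L[ℝ] E)
        fun x : M ↦ TangentSpace 𝓘(ℝ, E) x →L[ℝ] TangentSpace 𝓘(ℝ, E) x))
        (Icc (s₁ - ε) (s₁ + ε)) eH.source := fun s hs ↦ by
      rw [heH, hom_trivializationAt_source]
      exact ⟨hbase s hs, hbase s hs⟩
    have h1 := continuous_snd.comp_continuousOn
      (eH.continuousOn.comp hsec.continuousOn hmaps)
    refine h1.congr fun s _ ↦ ?_
    simp only [hAh, heH, Function.comp_apply, hom_trivializationAt_apply]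
  have hCc : ContinuousOn C (Icc (s₁ - ε) (s₁ + ε)) := hAhc.sub hΓc
  -- a bound, hence a Lipschitz constant, for the coefficient
  obtain ⟨K, hK⟩ := isCompact_Icc.exists_bound_of_continuousOn hCc
  set Kn : ℝ≥0 := ⟨max K 0, le_max_right _ _⟩ with hKn
  have hlip : ∀ s ∈ Ioo (s₁ - ε) (s₁ + ε),
      LipschitzOnWith Kn (fun x : E ↦ C s x) univ := fun s hs ↦ by
    have h := (C s).lipschitz
    refine (h.weaken ?_).lipschitzOnWith
    rw [← NNReal.coe_le_coe, coe_nnnorm]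
    exact (hK s (Ioo_subset_Icc_self hs)).trans (le_max_left _ _)
  refine ⟨ε, hε, ?_⟩
  rintro ⟨s₂, hs₂, hW0⟩ s hs
  have hw0 : w s₂ = 0 := by
    simp only [hw, hW0]
    rw [← Trivialization.continuousLinearMapAt_apply_of_mem ℝ e (hbase s₂ (Ioo_subset_Icc_self hs₂)),
      map_zero]
  have huniq := ODE_solution_unique_of_mem_Ioo (v := fun s x ↦ C s x) (s := fun _ ↦ univ)
    (f := w) (g := fun _ ↦ (0 : E)) hlip hs₂
    (fun s' hs' ↦ ⟨hwderiv s' (Ioo_subset_Icc_self hs'), mem_univ _⟩)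
    (fun s' _ ↦ ⟨by rw [map_zero]; exact hasDerivAt_const s' (0 : E), mem_univ _⟩) hw0
  have hws : w s = 0 := huniq hs
  have hb := hbase s (Ioo_subset_Icc_self hs)
  calc W s = e.symmL ℝ (γ s) (w s) := by
        simp only [hw]
        rw [← Trivialization.continuousLinearMapAt_apply_of_mem ℝ e hb,
          Trivialization.symmL_continuousLinearMapAt _ hb]
    _ = 0 := by rw [hws, map_zero]

/-- **Uniqueness for the linear covariant equation along a curve.** Let `∇` be locally `C^∞`, `A`
a continuous endomorphism field of `TM`, `γ` a `C¹` curve and `W` a field along `γ` with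
differentiable lift solving `DW/dt = A_{γ t}(W t)` for all `t`. If `W s₀ = 0` for one `s₀`, then
`W = 0`: the zero set is non-empty, and open and closed by the local propagation
(`exists_window_eq_zero_of_covariantDerivAlong_eq`), hence all of `ℝ`. O'Neill 1983, Ch. 3,
Prop. 3.19; Lee 2018, Thm. 4.31. [cite: ONeill1983, Ch. 3, Prop. 3.19] -/
theorem eq_zero_of_covariantDerivAlong_eq_apply
    (cov : CovariantDerivative 𝓘(ℝ, E) E (TangentSpace 𝓘(ℝ, E) : M → Type _))
    (hcov : cov.IsLocallyContMDiff ∞)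
    (A : Π x : M, TangentSpace 𝓘(ℝ, E) x →L[ℝ] TangentSpace 𝓘(ℝ, E) x)
    (hA : Continuous fun x ↦ (⟨x, A x⟩ : TotalSpace (E →L[ℝ] E)
      fun x : M ↦ TangentSpace 𝓘(ℝ, E) x →L[ℝ] TangentSpace 𝓘(ℝ, E) x))
    {γ : ℝ → M} (hγ : ContMDiff 𝓘(ℝ, ℝ) 𝓘(ℝ, E) 1 γ)
    {W : Π t : ℝ, TangentSpace 𝓘(ℝ, E) (γ t)}
    (hW : ∀ t, MDifferentiableAt 𝓘(ℝ, ℝ) (𝓘(ℝ, E).tangent)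
      (fun t' ↦ (TotalSpace.mk' E (γ t') (W t') : TangentBundle 𝓘(ℝ, E) M)) t)
    (hODE : ∀ t, covariantDerivAlong cov γ W t = A (γ t) (W t)) {s₀ : ℝ} (h0 : W s₀ = 0)
    (s : ℝ) : W s = 0 := by
  set S : Set ℝ := {s | W s = 0} with hS
  have hwin := exists_window_eq_zero_of_covariantDerivAlong_eq cov hcov A hA hγ hW hODE
  have hopen : IsOpen S := by
    refine isOpen_iff_mem_nhds.2 fun s₁ hs₁ ↦ ?_
    obtain ⟨ε, hε, hprop⟩ := hwin s₁
    have hall := hprop ⟨s₁, ⟨by linarith, by linarith⟩, hs₁⟩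
    exact mem_of_superset (Ioo_mem_nhds (by linarith) (by linarith)) fun s hs ↦ hall s hs
  have hclosed : IsClosed S := by
    refine isClosed_iff_clusterPt.2 fun s₁ hs₁ ↦ ?_
    obtain ⟨ε, hε, hprop⟩ := hwin s₁
    have hmem : s₁ ∈ closure S := mem_closure_iff_clusterPt.2 hs₁
    obtain ⟨s₂, hs₂S, hs₂⟩ := Metric.mem_closure_iff.1 hmem ε hε
    rw [Real.dist_eq, abs_lt] at hs₂
    have hall := hprop ⟨s₂, ⟨by linarith, by linarith⟩, hs₂S⟩
    exact hall s₁ ⟨by linarith, by linarith⟩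
  have hS_univ : S = univ :=
    IsClopen.eq_univ ⟨hclosed, hopen⟩ ⟨s₀, h0⟩
  have : s ∈ S := by rw [hS_univ]; exact mem_univ s
  exact this

end Local

end Literature.Geometry.Lorentzian
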